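import Summits.BirchSwinnertonDyer.Rank1Residual.Partition.MainConjecturesAnticyclotomicGood
import Summits.BirchSwinnertonDyer.Rank1Residual.Partition.MainConjecturesIrreducibleClass
import HarnessLib

/-!
# Rows C2 (`r = 1`) and C3-ordinary at MAIN-CONJECTURE level, one level BELOW STEP L: the
# anticyclotomic main conjecture (one divisibility ∘ BDP) and the anticyclotomic control theorem AS
# TYPED ON THE CONSTRUCTED `X_ac` + the cyclotomic main conjecture of the twist (typed, PUBLISHED) +
# cited control ⇒ BSD(E,p), CLASS level (cell `b2b-bsdres`, GLUE seat gen 3; companion of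
# `Partition/MainConjecturesAnticyclotomicGood.lean`, kept apart for the file-size lint)

HONEST FRAMING (cell `b2b-bsdres`, run/shared/lean/b2b/bsd-rank1-residual/, verbatim in every
file): the goal of the cell is to DELETE the COMBINATION-SHAPED residual classes of the
Birch–Swinnerton-Dyer formula for ALL analytic-rank `≤ 1` elliptic curves over `ℚ` — "full BSD
formula for every rank `≤ 1` curve in class `C`" assembled STRICTLY from published theorems — so
that the rank-`≤ 1` remainder becomes exactly the CONSTRUCTION-SHAPED classes, which are TYPED
(missing-input `Prop`s), NOT attempted. This is not "finishing BSD". Research routes; no claim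
beyond the stated classes; nothing booked; no label changes. THEOREMS ONLY (no definition, no named
fact, no `sorry`); every published theorem enters as one of the tree's existing named Literature
facts BY NAME; every unproved / untyped-in-Literature statement enters as an EXPLICIT binder.

## What this file records

Gen 2's class-level theorem `bsdp_rankOne_of_indexLowerBoundAt_of_columnMainConjecture` (and its
instances for rows C2 / C3-ord) has ONE typed input per pair: STEP L = `X11b.IndexLowerBoundAt W p K P`
(binder `hL`) at every Manin-unit classical Heegner datum over a field `K` with `d_K` odd `< −4`, every
`ℓ ∣ N` split, `p` split — the OUTPUT of "anticyclotomic main conjecture + BDP formula + anticyclotomic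
control" (BCS Cor. 1.3.1's printed proof). Here `hL` is REPLACED by its two antecedents AS TYPED ON THE
TREE'S CONSTRUCTED OBJECTS (the companion file's predicates, good-`p` twins of multr1's):

* `hLC` = (CTL)ᵍ `X11b.ControlOnTreeGoodAt p κ 𝔭 γ (embAt K p 𝔭) P` — Castella 2018 Thm. 2.3 with
  `ε_p = p⁻¹` (⇐ Jetchev–Skinner–Wan 2017 Thm. 3.3.1) on `X_ac = AcSelmer.XAc (E_K) p κ 𝔭 ∅ γ`, the
  formal-group logarithm through THE embedding `embAt`, `∏_{w∣N⁺} c_w(E/K)` — PUBLISHED SHAPE;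
* `hLA` = (IMC≥∘BDP)ᵍ `X11b.IMCLowerWaldspurgerOnTreeGoodAt p κ 𝔭 γ (embAt K p 𝔭) P` — one
  divisibility of the anticyclotomic main conjecture at `𝟙` composed with the BDP formula (Cas18
  Thm. 3.2, `ε_p = p⁻¹`) — IN PRINT on exactly the field data quantified here: Burungale–Castella–
  Skinner 2025 Thm. 1.2.4 (`p > 3`; (disc), (Heeg), (spl); equality, rationally under (irr_ℚ),
  integrally under (sur));
both demanded, for the pair at hand, at every such datum with `P` of infinite order and for EVERY
anticyclotomic `ℤ_p`-extension `κ`, generator `γ`, degree-one prime `𝔭 ∋ p` (existence: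
`X11b.exists_anticyclotomic_generator_degreeOnePrime`). So after this file the covered rank-one rows
C2 (`p > 3`) and C3-ordinary (`p ≥ 5`), on `p ∤ ∏_ℓ c_ℓ`, read in the kernel:
"(anticyclotomic MC, as typed on `X_ac`) + (anticyclotomic control, as typed on `X_ac`) + (cyclotomic
MC of the twist: the PUBLISHED named fact BCS Thm. 1.1.2 (b), as typed) + (Gross–Zagier, Kolyvagin,
Greenberg Thm. 4.1, Hoffstein–Luo, Mazur 1978, Néron, modularity, GZK: named facts) ⇒ `BSD(E,p)`" —
main conjecture (as typed) + control theorems (as typed) ⇒ BSD_p, with NO output-level binder left.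
Row C16 (`p = 3`, Yan–Zhu) keeps gen 2's `hL`: the Tamagawa transports over `K` are tree theorems for
`p ≥ 5` only (lit-cgls sized ask S10).

| theorem | locus | typed inputs | replaces (gen 2) |
|---|---|---|---|
| `bsdp_rankOne_of_onTreeGoodLinks_of_columnMainConjecture` | `p ≥ 5` good ordinary, surj, `r = 1`, `p ∤ ∏c_ℓ` | `hMC` (column MC at `p`), `hIm`, `hLC`, `hLA` | `…_of_indexLowerBoundAt_of_columnMainConjecture` |
| `bsdp_rankOne_of_onTreeGoodLinks_of_bcsThm112b` | BCS: `p > 3`, GoodOrd, Irr, BigIm, `r = 1`, `p ∤ ∏c_ℓ` | `hLC`, `hLA` (class-quantified) + BCS Thm. 1.1.2 (b) (named fact) | `…_of_indexLowerBoundAt_of_bcsThm112b` |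
| `RowC2.bsdp_rankOne_of_onTreeGoodLinks_of_bcsThm112b`, `RowC2.bsdp_of_bcsThm112b_of_onTreeGoodLinks` (`r ≤ 1`) | row C2 | same | `RowC2.…indexLowerBoundAt…` |
| `RowC3.bsdp_of_onTreeGoodLinks_of_bcsThm112b` | row C3 ∩ {GoodOrd, `p ≥ 5`, `p ∤ ∏c_ℓ`} | same + JSW §7.4 Ribet fact | `RowC3.bsdp_of_indexLowerBoundAt_of_bcsThm112b` |

References: [BurungaleCastellaSkinner2025] Thm. 1.1.2 (b), 1.2.4, Cor. 1.3.1 and its proof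
(arXiv:2405.00270v2 pp. 3–4); [Castella2018] Thm. 2.3, 3.2 (arXiv:1704.06608 pp. 5, 9);
[JetchevSkinnerWan2017] Thm. 3.3.1, §7.4.1 (arXiv:1512.06894 pp. 11, 30); [GreenbergLNM1716] Thm. 4.1;
[HoffsteinLuo1997]; [Mazur1978] Cor. 4.1; [GrossZagier1986]; [McCallumLMS1991]; [Miller2011LMS]
Def. 1.1; HOME/b2b-bsdres-lit-glue/GLUE.md §G2.4 (A4).
-/

set_option autoImplicit false

noncomputable section

open scoped Classical

open WeierstrassCurve NumberField IsDedekindDomain Literature.NumberTheory.EllipticCurves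
  Literature.NumberTheory.EllipticCurves.ModularForms
  Literature.NumberTheory.EllipticCurves.Rank1Residual
  Literature.NumberTheory.EllipticCurves.BurungaleCastellaSkinner2025
  Summit.BirchSwinnertonDyer.BirchSwinnertonDyer.Theorems.Rank1ResidualX1Defs

namespace Summit.BirchSwinnertonDyer.Rank1Residual

/-! ### Rank one at the class level from the column's typed cyclotomic MC and the two on-tree anticyclotomic links -/

/-- **Rank one at the class level, generic in the prime `p ≥ 5`, from the column's typed cyclotomic
main conjecture and the two GOOD-`p` ANTICYCLOTOMIC LINKS ON THE CONSTRUCTED `X_ac`.** Exactly gen 2's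
`bsdp_rankOne_of_indexLowerBoundAt_of_columnMainConjecture` (published named facts `hGZ`, `hKo`, `hB`,
`hGr`, `hGZK`, `hmod`, `hpar`, `hnf`, `hHL`, `hMaz`, `hNS`; the column's typed MC `hMC` at `p` and the
(im)-from-surj witness `hIm`) with its OUTPUT-level binder `hL` (STEP L) REPLACED by the two antecedents
of STEP L as typed on tree objects, demanded for THIS pair at every Manin-unit classical Heegner datum
over a field with `d_K` odd `< −4`, every `ℓ ∣ N` split, `p` split, `L(E^{d_K},1) ≠ 0`, at the
(non-torsion) Heegner point, for every anticyclotomic `κ`, generator `γ`, degree-one `𝔭 ∋ p`, with THE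
embedding `embAt K p 𝔭`: `hLC` = (CTL)ᵍ (Cas18 Thm. 2.3, `ε_p = p⁻¹` ⇐ JSW17 Thm. 3.3.1 — PUBLISHED
shape) and `hLA` = (IMC≥∘BDP)ᵍ (BCS 2025 Thm. 1.2.4 ∘ Cas18 Thm. 3.2 — PUBLISHED shape on these data).
Proof: STEP L at each datum is the companion's `X11b.indexLowerBoundAt_of_heegner_of_onTreeGoodInputs`
(finiteness of `Ш(E/K)` and non-torsion of `P_K` by Gross–Zagier + Kolyvagin + modularity), then gen 2.
[cite: BurungaleCastellaSkinner2025, Cor. 1.3.1 (r = 1) and its proof (p. 4); Thm. 1.2.4]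
[cite: Castella2018, Thm. 2.3 (p. 5), Thm. 3.2 (p. 9)] [cite: JetchevSkinnerWan2017, Thm. 3.3.1, §7.4.1 (pp. 11, 30)]
[cite: Miller2011LMS, Def. 1.1] -/
theorem bsdp_rankOne_of_onTreeGoodLinks_of_columnMainConjecture
    -- published inputs (named facts of the tree)
    (hGZ : ∀ (N : ℕ) [NeZero N] (W : WeierstrassCurve ℚ) (K : Type) [Field K] [NumberField K],
      gross_zagier N W K)
    (hKo : ∀ (N : ℕ) [NeZero N] (W : WeierstrassCurve ℚ) (K : Type) [Field K] [NumberField K],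
      kolyvagin N W K)
    (hB : ∀ (N : ℕ) [NeZero N] (W : WeierstrassCurve ℚ) (K : Type) [Field K] [NumberField K],
      Kolyvagin1990_padicValNat_card_sha_le N W K)
    (hGr : greenberg_charValue_rankZero) (hGZK : rank_eq_analyticRank_of_analyticRank_le_one)
    (hmod : hasEntireLFunction_rat) (hpar : nonempty_modularParametrizationData)
    (hnf : exists_isNewformOf) (hHL : HoffsteinLuo1997_exists_twist_L_one_ne_zero)
    (hMaz : mazur_not_dvd_maninConstant_of_odd) (hNS : integral_neronScaling_of_isGloballyMinimal)
    -- the pair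
    (W : WeierstrassCurve ℚ) [W.IsElliptic] [W.IsGloballyMinimal] (p : ℕ) [Fact p.Prime]
    (hp5 : 5 ≤ p) (hord : GoodOrd W p) (hsurj : Surj W p) (hr : W.analyticRank = 1)
    (htam0 : ¬ p ∣ W.tamagawaProduct)
    -- the column's typed cyclotomic main conjecture at `p`, and the (im)-from-surj witness at `p`
    (hMC : ∀ (V : WeierstrassCurve ℚ) [V.IsElliptic] [V.IsGloballyMinimal],
      GoodOrd V p → Irr V p → BigIm V p → MazurMainConjecture V p)
    (hIm : ∀ (V : WeierstrassCurve ℚ) [V.IsElliptic] [V.IsGloballyMinimal],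
      GoodOrd V p → Surj V p → BigIm V p)
    -- (CTL)ᵍ on the constructed `X_ac` at every classical Heegner datum of this pair — PUBLISHED shape
    (hLC : ∀ (N : ℕ) [NeZero N] (K : Type) [Field K] [NumberField K]
      (Dt : ModularParametrizationData W N) (H : HeegnerDatum N (NumberField.discr K)) (ι : K →+* ℂ)
      (P : (W.baseChange K).toAffine.Point),
      W.conductorNorm ℤ = N → IsImaginaryQuadratic K → Odd (NumberField.discr K) →
      NumberField.discr K < -4 → SatisfiesHeegnerHypothesis N K → SatisfiesHeegnerHypothesis p K →
      (W.quadraticTwist (NumberField.discr K : ℚ)).entireLFunction 1 ≠ 0 →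
      WeierstrassCurve.Affine.Point.map ι.toRatAlgHom P = heegnerPointComplex Dt H →
      ¬ (p : ℤ) ∣ Dt.c → ¬ IsOfFinAddOrder P →
      ∀ (κ : ZpExtension K p), κ.IsAnticyclotomic →
        ∀ (γ : Field.absoluteGaloisGroup K) [Fact (κ.IsTopGenerator γ)]
          (𝔭 : HeightOneSpectrum (𝓞 K)) (h𝔭 : ((p : ℕ) : 𝓞 K) ∈ 𝔭.asIdeal)
          (he : 𝔭.asIdeal.ramificationIdx (𝓞 ℚ) = 1) (hf : 𝔭.asIdeal.inertiaDeg (𝓞 ℚ) = 1),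
          X11b.ControlOnTreeGoodAt p κ 𝔭 γ (X11b.embAt K p 𝔭 h𝔭 he hf) P)
    -- (IMC≥∘BDP)ᵍ on the constructed `X_ac` at the same data — PUBLISHED shape (BCS Thm. 1.2.4 ∘ BDP)
    (hLA : ∀ (N : ℕ) [NeZero N] (K : Type) [Field K] [NumberField K]
      (Dt : ModularParametrizationData W N) (H : HeegnerDatum N (NumberField.discr K)) (ι : K →+* ℂ)
      (P : (W.baseChange K).toAffine.Point),
      W.conductorNorm ℤ = N → IsImaginaryQuadratic K → Odd (NumberField.discr K) →
      NumberField.discr K < -4 → SatisfiesHeegnerHypothesis N K → SatisfiesHeegnerHypothesis p K →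
      (W.quadraticTwist (NumberField.discr K : ℚ)).entireLFunction 1 ≠ 0 →
      WeierstrassCurve.Affine.Point.map ι.toRatAlgHom P = heegnerPointComplex Dt H →
      ¬ (p : ℤ) ∣ Dt.c → ¬ IsOfFinAddOrder P →
      ∀ (κ : ZpExtension K p), κ.IsAnticyclotomic →
        ∀ (γ : Field.absoluteGaloisGroup K) [Fact (κ.IsTopGenerator γ)]
          (𝔭 : HeightOneSpectrum (𝓞 K)) (h𝔭 : ((p : ℕ) : 𝓞 K) ∈ 𝔭.asIdeal)
          (he : 𝔭.asIdeal.ramificationIdx (𝓞 ℚ) = 1) (hf : 𝔭.asIdeal.inertiaDeg (𝓞 ℚ) = 1),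
          X11b.IMCLowerWaldspurgerOnTreeGoodAt p κ 𝔭 γ (X11b.embAt K p 𝔭 h𝔭 he hf) P) :
    BSDp W p :=
  bsdp_rankOne_of_indexLowerBoundAt_of_columnMainConjecture hGZ hKo hB hGr hGZK hmod hpar hnf hHL hMaz
    hNS W p (by omega) hord hsurj hr htam0 hMC hIm
    (fun N _ K _ _ Dt H ι P hN hK hodd hlt hHN hHp hLt hP hc ↦
      have hPinf : ¬ IsOfFinAddOrder P :=
        X11b.not_isOfFinAddOrder_of_heegner_of_analyticRank_eq_one W N K Dt H ι P (hGZ N W K) hmod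
          hr hK hHN hLt hP
      X11b.indexLowerBoundAt_of_heegner_of_onTreeGoodInputs W p N K Dt H ι P (hGZ N W K) (hKo N W K)
        hmod hp5 hr hN hK hHN hHp hLt hP
        (fun κ hκ γ _ 𝔭 h𝔭 he hf ↦
          hLC N K Dt H ι P hN hK hodd hlt hHN hHp hLt hP hc hPinf κ hκ γ 𝔭 h𝔭 he hf)
        (fun κ hκ γ _ 𝔭 h𝔭 he hf ↦
          hLA N K Dt H ι P hN hK hodd hlt hHN hHp hLt hP hc hPinf κ hκ γ 𝔭 h𝔭 he hf))

/-! ### BCS's locus and rows C2 / C3-ordinary -/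

/-- **Rank one on BCS's locus (`p > 3`, good ordinary, (irr), (im), `p ∤ ∏c_ℓ`), CLASS level, from
the two good-`p` anticyclotomic links on `X_ac` and BCS Thm. 1.1.2 (b).** The generic theorem with
`hMC` = `thm112b_charIdeal_eq_padicLFunction_integral` (`hBCS`, PUBLISHED named fact), `hIm` =
`X9.bigIm_of_surj` (`p ≥ 5`), surjectivity from (irr) + (im), and (`hLC`, `hLA`) quantified as CLASS
inputs (all pairs of the locus, all admissible data). Replaces gen 2's
`bsdp_rankOne_of_indexLowerBoundAt_of_bcsThm112b` (binder `hL` = STEP L, the output).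
[cite: BurungaleCastellaSkinner2025, Cor. 1.3.1 (r = 1) and its proof (p. 4); Thm. 1.2.4; Thm. 1.1.2 (b)]
[cite: Castella2018, Thm. 2.3 (p. 5), Thm. 3.2 (p. 9)] [cite: Miller2011LMS, Def. 1.1] -/
theorem bsdp_rankOne_of_onTreeGoodLinks_of_bcsThm112b
    (hGZ : ∀ (N : ℕ) [NeZero N] (W : WeierstrassCurve ℚ) (K : Type) [Field K] [NumberField K],
      gross_zagier N W K)
    (hKo : ∀ (N : ℕ) [NeZero N] (W : WeierstrassCurve ℚ) (K : Type) [Field K] [NumberField K],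
      kolyvagin N W K)
    (hB : ∀ (N : ℕ) [NeZero N] (W : WeierstrassCurve ℚ) (K : Type) [Field K] [NumberField K],
      Kolyvagin1990_padicValNat_card_sha_le N W K)
    (hBCS : thm112b_charIdeal_eq_padicLFunction_integral) (hGr : greenberg_charValue_rankZero)
    (hGZK : rank_eq_analyticRank_of_analyticRank_le_one) (hmod : hasEntireLFunction_rat)
    (hpar : nonempty_modularParametrizationData) (hnf : exists_isNewformOf)
    (hHL : HoffsteinLuo1997_exists_twist_L_one_ne_zero)
    (hMaz : mazur_not_dvd_maninConstant_of_odd) (hNS : integral_neronScaling_of_isGloballyMinimal)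
    (hLC : ∀ (W : WeierstrassCurve ℚ) [W.IsElliptic] [W.IsGloballyMinimal] (p : ℕ) [Fact p.Prime]
      (N : ℕ) [NeZero N] (K : Type) [Field K] [NumberField K]
      (Dt : ModularParametrizationData W N) (H : HeegnerDatum N (NumberField.discr K)) (ι : K →+* ℂ)
      (P : (W.baseChange K).toAffine.Point),
      3 < p → GoodOrd W p → Irr W p → BigIm W p → W.analyticRank = 1 → ¬ p ∣ W.tamagawaProduct →
      W.conductorNorm ℤ = N → IsImaginaryQuadratic K → Odd (NumberField.discr K) →
      NumberField.discr K < -4 → SatisfiesHeegnerHypothesis N K → SatisfiesHeegnerHypothesis p K →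
      (W.quadraticTwist (NumberField.discr K : ℚ)).entireLFunction 1 ≠ 0 →
      WeierstrassCurve.Affine.Point.map ι.toRatAlgHom P = heegnerPointComplex Dt H →
      ¬ (p : ℤ) ∣ Dt.c → ¬ IsOfFinAddOrder P →
      ∀ (κ : ZpExtension K p), κ.IsAnticyclotomic →
        ∀ (γ : Field.absoluteGaloisGroup K) [Fact (κ.IsTopGenerator γ)]
          (𝔭 : HeightOneSpectrum (𝓞 K)) (h𝔭 : ((p : ℕ) : 𝓞 K) ∈ 𝔭.asIdeal)
          (he : 𝔭.asIdeal.ramificationIdx (𝓞 ℚ) = 1) (hf : 𝔭.asIdeal.inertiaDeg (𝓞 ℚ) = 1),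
          X11b.ControlOnTreeGoodAt p κ 𝔭 γ (X11b.embAt K p 𝔭 h𝔭 he hf) P)
    (hLA : ∀ (W : WeierstrassCurve ℚ) [W.IsElliptic] [W.IsGloballyMinimal] (p : ℕ) [Fact p.Prime]
      (N : ℕ) [NeZero N] (K : Type) [Field K] [NumberField K]
      (Dt : ModularParametrizationData W N) (H : HeegnerDatum N (NumberField.discr K)) (ι : K →+* ℂ)
      (P : (W.baseChange K).toAffine.Point),
      3 < p → GoodOrd W p → Irr W p → BigIm W p → W.analyticRank = 1 → ¬ p ∣ W.tamagawaProduct →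
      W.conductorNorm ℤ = N → IsImaginaryQuadratic K → Odd (NumberField.discr K) →
      NumberField.discr K < -4 → SatisfiesHeegnerHypothesis N K → SatisfiesHeegnerHypothesis p K →
      (W.quadraticTwist (NumberField.discr K : ℚ)).entireLFunction 1 ≠ 0 →
      WeierstrassCurve.Affine.Point.map ι.toRatAlgHom P = heegnerPointComplex Dt H →
      ¬ (p : ℤ) ∣ Dt.c → ¬ IsOfFinAddOrder P →
      ∀ (κ : ZpExtension K p), κ.IsAnticyclotomic →
        ∀ (γ : Field.absoluteGaloisGroup K) [Fact (κ.IsTopGenerator γ)]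
          (𝔭 : HeightOneSpectrum (𝓞 K)) (h𝔭 : ((p : ℕ) : 𝓞 K) ∈ 𝔭.asIdeal)
          (he : 𝔭.asIdeal.ramificationIdx (𝓞 ℚ) = 1) (hf : 𝔭.asIdeal.inertiaDeg (𝓞 ℚ) = 1),
          X11b.IMCLowerWaldspurgerOnTreeGoodAt p κ 𝔭 γ (X11b.embAt K p 𝔭 h𝔭 he hf) P)
    (W : WeierstrassCurve ℚ) [W.IsElliptic] [W.IsGloballyMinimal] (p : ℕ) [Fact p.Prime]
    (hp : 3 < p) (hord : GoodOrd W p) (hirr : Irr W p) (him : BigIm W p) (hr : W.analyticRank = 1)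
    (htam0 : ¬ p ∣ W.tamagawaProduct) : BSDp W p :=
  have hp5 : 5 ≤ p := (Fact.out : p.Prime).five_le_of_ne_two_of_ne_three (by omega) (by omega)
  bsdp_rankOne_of_onTreeGoodLinks_of_columnMainConjecture hGZ hKo hB hGr hGZK hmod hpar hnf hHL hMaz hNS
    W p hp5 hord (surj_of_irr_of_bigIm W p hirr him) hr htam0
    (fun V _ _ hordV hirrV himV ↦ hBCS V p hp hordV hirrV himV)
    (fun V _ _ _ hsV ↦ X9.bigIm_of_surj V p hp5 hsV)
    (fun N _ K _ _ Dt H ι P hN hK hodd hlt hHN hHp hLt hP hc hPinf ↦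
      hLC W p N K Dt H ι P hp hord hirr him hr htam0 hN hK hodd hlt hHN hHp hLt hP hc hPinf)
    (fun N _ K _ _ Dt H ι P hN hK hodd hlt hHN hHp hLt hP hc hPinf ↦
      hLA W p N K Dt H ι P hp hord hirr him hr htam0 hN hK hodd hlt hHN hHp hLt hP hc hPinf)

/-- **C2 ∩ {r = 1}, `p ∤ ∏ c_ℓ`, along its PRINTED route one level below STEP L** (BCS Cor. 1.3.1,
`r = 1`: "Theorem 1.2.4, the `p`-adic Waldspurger formula …, the anticyclotomic control theorem [JSW17,
Thm. 3.3.1], and the `r = 0` result for the `K`-quadratic twist"): the two good-`p` anticyclotomic links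
as typed on `X_ac` + BCS Thm. 1.1.2 (b) (named fact) + cited control ⇒ `BSD(E,p)`. Replaces gen 2's
`RowC2.bsdp_rankOne_of_indexLowerBoundAt_of_bcsThm112b`.
[cite: BurungaleCastellaSkinner2025, Cor. 1.3.1 (r = 1) and its proof (p. 4); Thm. 1.2.4; Thm. 1.1.2 (b)] -/
theorem RowC2.bsdp_rankOne_of_onTreeGoodLinks_of_bcsThm112b
    (hGZ : ∀ (N : ℕ) [NeZero N] (W : WeierstrassCurve ℚ) (K : Type) [Field K] [NumberField K],
      gross_zagier N W K)
    (hKo : ∀ (N : ℕ) [NeZero N] (W : WeierstrassCurve ℚ) (K : Type) [Field K] [NumberField K],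
      kolyvagin N W K)
    (hB : ∀ (N : ℕ) [NeZero N] (W : WeierstrassCurve ℚ) (K : Type) [Field K] [NumberField K],
      Kolyvagin1990_padicValNat_card_sha_le N W K)
    (hBCS : thm112b_charIdeal_eq_padicLFunction_integral) (hGr : greenberg_charValue_rankZero)
    (hGZK : rank_eq_analyticRank_of_analyticRank_le_one) (hmod : hasEntireLFunction_rat)
    (hpar : nonempty_modularParametrizationData) (hnf : exists_isNewformOf)
    (hHL : HoffsteinLuo1997_exists_twist_L_one_ne_zero)
    (hMaz : mazur_not_dvd_maninConstant_of_odd) (hNS : integral_neronScaling_of_isGloballyMinimal)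
    (hLC : ∀ (W : WeierstrassCurve ℚ) [W.IsElliptic] [W.IsGloballyMinimal] (p : ℕ) [Fact p.Prime]
      (N : ℕ) [NeZero N] (K : Type) [Field K] [NumberField K]
      (Dt : ModularParametrizationData W N) (H : HeegnerDatum N (NumberField.discr K)) (ι : K →+* ℂ)
      (P : (W.baseChange K).toAffine.Point),
      3 < p → GoodOrd W p → Irr W p → BigIm W p → W.analyticRank = 1 → ¬ p ∣ W.tamagawaProduct →
      W.conductorNorm ℤ = N → IsImaginaryQuadratic K → Odd (NumberField.discr K) →
      NumberField.discr K < -4 → SatisfiesHeegnerHypothesis N K → SatisfiesHeegnerHypothesis p K →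
      (W.quadraticTwist (NumberField.discr K : ℚ)).entireLFunction 1 ≠ 0 →
      WeierstrassCurve.Affine.Point.map ι.toRatAlgHom P = heegnerPointComplex Dt H →
      ¬ (p : ℤ) ∣ Dt.c → ¬ IsOfFinAddOrder P →
      ∀ (κ : ZpExtension K p), κ.IsAnticyclotomic →
        ∀ (γ : Field.absoluteGaloisGroup K) [Fact (κ.IsTopGenerator γ)]
          (𝔭 : HeightOneSpectrum (𝓞 K)) (h𝔭 : ((p : ℕ) : 𝓞 K) ∈ 𝔭.asIdeal)
          (he : 𝔭.asIdeal.ramificationIdx (𝓞 ℚ) = 1) (hf : 𝔭.asIdeal.inertiaDeg (𝓞 ℚ) = 1),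
          X11b.ControlOnTreeGoodAt p κ 𝔭 γ (X11b.embAt K p 𝔭 h𝔭 he hf) P)
    (hLA : ∀ (W : WeierstrassCurve ℚ) [W.IsElliptic] [W.IsGloballyMinimal] (p : ℕ) [Fact p.Prime]
      (N : ℕ) [NeZero N] (K : Type) [Field K] [NumberField K]
      (Dt : ModularParametrizationData W N) (H : HeegnerDatum N (NumberField.discr K)) (ι : K →+* ℂ)
      (P : (W.baseChange K).toAffine.Point),
      3 < p → GoodOrd W p → Irr W p → BigIm W p → W.analyticRank = 1 → ¬ p ∣ W.tamagawaProduct →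
      W.conductorNorm ℤ = N → IsImaginaryQuadratic K → Odd (NumberField.discr K) →
      NumberField.discr K < -4 → SatisfiesHeegnerHypothesis N K → SatisfiesHeegnerHypothesis p K →
      (W.quadraticTwist (NumberField.discr K : ℚ)).entireLFunction 1 ≠ 0 →
      WeierstrassCurve.Affine.Point.map ι.toRatAlgHom P = heegnerPointComplex Dt H →
      ¬ (p : ℤ) ∣ Dt.c → ¬ IsOfFinAddOrder P →
      ∀ (κ : ZpExtension K p), κ.IsAnticyclotomic →
        ∀ (γ : Field.absoluteGaloisGroup K) [Fact (κ.IsTopGenerator γ)]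
          (𝔭 : HeightOneSpectrum (𝓞 K)) (h𝔭 : ((p : ℕ) : 𝓞 K) ∈ 𝔭.asIdeal)
          (he : 𝔭.asIdeal.ramificationIdx (𝓞 ℚ) = 1) (hf : 𝔭.asIdeal.inertiaDeg (𝓞 ℚ) = 1),
          X11b.IMCLowerWaldspurgerOnTreeGoodAt p κ 𝔭 γ (X11b.embAt K p 𝔭 h𝔭 he hf) P)
    (W : WeierstrassCurve ℚ) [W.IsElliptic] [W.IsGloballyMinimal] (p : ℕ) [Fact p.Prime]
    (h : RowC2 W p) (hr1 : W.analyticRank = 1) (htam0 : ¬ p ∣ W.tamagawaProduct) : BSDp W p :=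
  Summit.BirchSwinnertonDyer.Rank1Residual.bsdp_rankOne_of_onTreeGoodLinks_of_bcsThm112b hGZ hKo hB
    hBCS hGr hGZK hmod hpar hnf hHL hMaz hNS hLC hLA W p h.2.1 h.2.2.1 h.2.2.2.1 h.2.2.2.2 hr1 htam0

/-- **Row C2 (`r ≤ 1`) entirely at "typed cyclotomic main conjecture (PUBLISHED: BCS Thm. 1.1.2 (b)) +
typed ANTICYCLOTOMIC main conjecture and control ON THE CONSTRUCTED `X_ac` (PUBLISHED: BCS Thm. 1.2.4,
Cas18 Thm. 2.3 / JSW17 Thm. 3.3.1) + cited control"**: `r = 0` by `RowC2.bsdp_rankZero_of_bcsThm112b`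
(gen 2); `r = 1` (with `p ∤ ∏c_ℓ`, where STEP L and Kolyvagin's bound meet) by
`RowC2.bsdp_rankOne_of_onTreeGoodLinks_of_bcsThm112b`. Replaces gen 2's
`RowC2.bsdp_of_bcsThm112b_of_indexLowerBoundAt`. [cite: BurungaleCastellaSkinner2025, Cor. 1.3.1 and its proof (p. 4)]
[cite: Miller2011LMS, Def. 1.1] -/
theorem RowC2.bsdp_of_bcsThm112b_of_onTreeGoodLinks
    (hGZ : ∀ (N : ℕ) [NeZero N] (W : WeierstrassCurve ℚ) (K : Type) [Field K] [NumberField K],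
      gross_zagier N W K)
    (hKo : ∀ (N : ℕ) [NeZero N] (W : WeierstrassCurve ℚ) (K : Type) [Field K] [NumberField K],
      kolyvagin N W K)
    (hB : ∀ (N : ℕ) [NeZero N] (W : WeierstrassCurve ℚ) (K : Type) [Field K] [NumberField K],
      Kolyvagin1990_padicValNat_card_sha_le N W K)
    (hBCS : thm112b_charIdeal_eq_padicLFunction_integral) (hGr : greenberg_charValue_rankZero)
    (hGZK : rank_eq_analyticRank_of_analyticRank_le_one) (hmod : hasEntireLFunction_rat)
    (hpar : nonempty_modularParametrizationData) (hnf : exists_isNewformOf)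
    (hHL : HoffsteinLuo1997_exists_twist_L_one_ne_zero)
    (hMaz : mazur_not_dvd_maninConstant_of_odd) (hNS : integral_neronScaling_of_isGloballyMinimal)
    (hLC : ∀ (W : WeierstrassCurve ℚ) [W.IsElliptic] [W.IsGloballyMinimal] (p : ℕ) [Fact p.Prime]
      (N : ℕ) [NeZero N] (K : Type) [Field K] [NumberField K]
      (Dt : ModularParametrizationData W N) (H : HeegnerDatum N (NumberField.discr K)) (ι : K →+* ℂ)
      (P : (W.baseChange K).toAffine.Point),
      3 < p → GoodOrd W p → Irr W p → BigIm W p → W.analyticRank = 1 → ¬ p ∣ W.tamagawaProduct →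
      W.conductorNorm ℤ = N → IsImaginaryQuadratic K → Odd (NumberField.discr K) →
      NumberField.discr K < -4 → SatisfiesHeegnerHypothesis N K → SatisfiesHeegnerHypothesis p K →
      (W.quadraticTwist (NumberField.discr K : ℚ)).entireLFunction 1 ≠ 0 →
      WeierstrassCurve.Affine.Point.map ι.toRatAlgHom P = heegnerPointComplex Dt H →
      ¬ (p : ℤ) ∣ Dt.c → ¬ IsOfFinAddOrder P →
      ∀ (κ : ZpExtension K p), κ.IsAnticyclotomic →
        ∀ (γ : Field.absoluteGaloisGroup K) [Fact (κ.IsTopGenerator γ)]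
          (𝔭 : HeightOneSpectrum (𝓞 K)) (h𝔭 : ((p : ℕ) : 𝓞 K) ∈ 𝔭.asIdeal)
          (he : 𝔭.asIdeal.ramificationIdx (𝓞 ℚ) = 1) (hf : 𝔭.asIdeal.inertiaDeg (𝓞 ℚ) = 1),
          X11b.ControlOnTreeGoodAt p κ 𝔭 γ (X11b.embAt K p 𝔭 h𝔭 he hf) P)
    (hLA : ∀ (W : WeierstrassCurve ℚ) [W.IsElliptic] [W.IsGloballyMinimal] (p : ℕ) [Fact p.Prime]
      (N : ℕ) [NeZero N] (K : Type) [Field K] [NumberField K]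
      (Dt : ModularParametrizationData W N) (H : HeegnerDatum N (NumberField.discr K)) (ι : K →+* ℂ)
      (P : (W.baseChange K).toAffine.Point),
      3 < p → GoodOrd W p → Irr W p → BigIm W p → W.analyticRank = 1 → ¬ p ∣ W.tamagawaProduct →
      W.conductorNorm ℤ = N → IsImaginaryQuadratic K → Odd (NumberField.discr K) →
      NumberField.discr K < -4 → SatisfiesHeegnerHypothesis N K → SatisfiesHeegnerHypothesis p K →
      (W.quadraticTwist (NumberField.discr K : ℚ)).entireLFunction 1 ≠ 0 →
      WeierstrassCurve.Affine.Point.map ι.toRatAlgHom P = heegnerPointComplex Dt H →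
      ¬ (p : ℤ) ∣ Dt.c → ¬ IsOfFinAddOrder P →
      ∀ (κ : ZpExtension K p), κ.IsAnticyclotomic →
        ∀ (γ : Field.absoluteGaloisGroup K) [Fact (κ.IsTopGenerator γ)]
          (𝔭 : HeightOneSpectrum (𝓞 K)) (h𝔭 : ((p : ℕ) : 𝓞 K) ∈ 𝔭.asIdeal)
          (he : 𝔭.asIdeal.ramificationIdx (𝓞 ℚ) = 1) (hf : 𝔭.asIdeal.inertiaDeg (𝓞 ℚ) = 1),
          X11b.IMCLowerWaldspurgerOnTreeGoodAt p κ 𝔭 γ (X11b.embAt K p 𝔭 h𝔭 he hf) P)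
    (W : WeierstrassCurve ℚ) [W.IsElliptic] [W.IsGloballyMinimal] (p : ℕ) [Fact p.Prime]
    (h : RowC2 W p) (hr : W.analyticRank ≤ 1)
    (htam0 : W.analyticRank = 1 → ¬ p ∣ W.tamagawaProduct) : BSDp W p := by
  rcases Nat.lt_or_ge W.analyticRank 1 with h0 | h1
  · exact RowC2.bsdp_rankZero_of_bcsThm112b hBCS hGr hpar hGZK h (by omega)
  · have hr1 : W.analyticRank = 1 := le_antisymm hr h1
    exact RowC2.bsdp_rankOne_of_onTreeGoodLinks_of_bcsThm112b hGZ hKo hB hBCS hGr hGZK hmod hpar hnf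
      hHL hMaz hNS hLC hLA W p h hr1 (htam0 hr1)

/-- **Row C3's ORDINARY part (`p ≥ 5`, `p ∤ ∏c_ℓ`) one level below STEP L**: a semistable `E` with
`E[p]` irreducible and `ord_{s=1} L(E,s) = 1` has a (ram) prime (JSW §7.4, Ribet: `hRib`), hence (im)
(`X9.bigIm_of_irr_of_ram`), so it lies on BCS's locus and `bsdp_rankOne_of_onTreeGoodLinks_of_bcsThm112b`
applies: the two good-`p` anticyclotomic links as typed on `X_ac` (over a field with every `ℓ ∣ N` and
`p` split, `d_K` odd — where the anticyclotomic main conjecture IS in print, BCS Thm. 1.2.4, unlike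
JSW's own `K'` with a non-split `q`; cell finding C186) + BCS Thm. 1.1.2 (b) for the twist + cited
control ⇒ `BSD(E,p)`. Replaces gen 2's `RowC3.bsdp_of_indexLowerBoundAt_of_bcsThm112b`.
[cite: JetchevSkinnerWan2017, Thm. 1.2.1, Thm. 3.3.1 and §7.4 (Ribet step; §7.4.1)]
[cite: BurungaleCastellaSkinner2025, Thm. 1.2.4, Cor. 1.3.1 (proof)] [cite: Castella2018, Thm. 2.3, Thm. 3.2] -/
theorem RowC3.bsdp_of_onTreeGoodLinks_of_bcsThm112b
    (hGZ : ∀ (N : ℕ) [NeZero N] (W : WeierstrassCurve ℚ) (K : Type) [Field K] [NumberField K],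
      gross_zagier N W K)
    (hKo : ∀ (N : ℕ) [NeZero N] (W : WeierstrassCurve ℚ) (K : Type) [Field K] [NumberField K],
      kolyvagin N W K)
    (hB : ∀ (N : ℕ) [NeZero N] (W : WeierstrassCurve ℚ) (K : Type) [Field K] [NumberField K],
      Kolyvagin1990_padicValNat_card_sha_le N W K)
    (hBCS : thm112b_charIdeal_eq_padicLFunction_integral) (hGr : greenberg_charValue_rankZero)
    (hGZK : rank_eq_analyticRank_of_analyticRank_le_one) (hmod : hasEntireLFunction_rat)
    (hpar : nonempty_modularParametrizationData) (hnf : exists_isNewformOf)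
    (hHL : HoffsteinLuo1997_exists_twist_L_one_ne_zero)
    (hMaz : mazur_not_dvd_maninConstant_of_odd) (hNS : integral_neronScaling_of_isGloballyMinimal)
    (hRib : JetchevSkinnerWan2017.sec74_exists_ramifiedPrime_of_semistable)
    (hLC : ∀ (W : WeierstrassCurve ℚ) [W.IsElliptic] [W.IsGloballyMinimal] (p : ℕ) [Fact p.Prime]
      (N : ℕ) [NeZero N] (K : Type) [Field K] [NumberField K]
      (Dt : ModularParametrizationData W N) (H : HeegnerDatum N (NumberField.discr K)) (ι : K →+* ℂ)
      (P : (W.baseChange K).toAffine.Point),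
      3 < p → GoodOrd W p → Irr W p → BigIm W p → W.analyticRank = 1 → ¬ p ∣ W.tamagawaProduct →
      W.conductorNorm ℤ = N → IsImaginaryQuadratic K → Odd (NumberField.discr K) →
      NumberField.discr K < -4 → SatisfiesHeegnerHypothesis N K → SatisfiesHeegnerHypothesis p K →
      (W.quadraticTwist (NumberField.discr K : ℚ)).entireLFunction 1 ≠ 0 →
      WeierstrassCurve.Affine.Point.map ι.toRatAlgHom P = heegnerPointComplex Dt H →
      ¬ (p : ℤ) ∣ Dt.c → ¬ IsOfFinAddOrder P →
      ∀ (κ : ZpExtension K p), κ.IsAnticyclotomic →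
        ∀ (γ : Field.absoluteGaloisGroup K) [Fact (κ.IsTopGenerator γ)]
          (𝔭 : HeightOneSpectrum (𝓞 K)) (h𝔭 : ((p : ℕ) : 𝓞 K) ∈ 𝔭.asIdeal)
          (he : 𝔭.asIdeal.ramificationIdx (𝓞 ℚ) = 1) (hf : 𝔭.asIdeal.inertiaDeg (𝓞 ℚ) = 1),
          X11b.ControlOnTreeGoodAt p κ 𝔭 γ (X11b.embAt K p 𝔭 h𝔭 he hf) P)
    (hLA : ∀ (W : WeierstrassCurve ℚ) [W.IsElliptic] [W.IsGloballyMinimal] (p : ℕ) [Fact p.Prime]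
      (N : ℕ) [NeZero N] (K : Type) [Field K] [NumberField K]
      (Dt : ModularParametrizationData W N) (H : HeegnerDatum N (NumberField.discr K)) (ι : K →+* ℂ)
      (P : (W.baseChange K).toAffine.Point),
      3 < p → GoodOrd W p → Irr W p → BigIm W p → W.analyticRank = 1 → ¬ p ∣ W.tamagawaProduct →
      W.conductorNorm ℤ = N → IsImaginaryQuadratic K → Odd (NumberField.discr K) →
      NumberField.discr K < -4 → SatisfiesHeegnerHypothesis N K → SatisfiesHeegnerHypothesis p K →
      (W.quadraticTwist (NumberField.discr K : ℚ)).entireLFunction 1 ≠ 0 →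
      WeierstrassCurve.Affine.Point.map ι.toRatAlgHom P = heegnerPointComplex Dt H →
      ¬ (p : ℤ) ∣ Dt.c → ¬ IsOfFinAddOrder P →
      ∀ (κ : ZpExtension K p), κ.IsAnticyclotomic →
        ∀ (γ : Field.absoluteGaloisGroup K) [Fact (κ.IsTopGenerator γ)]
          (𝔭 : HeightOneSpectrum (𝓞 K)) (h𝔭 : ((p : ℕ) : 𝓞 K) ∈ 𝔭.asIdeal)
          (he : 𝔭.asIdeal.ramificationIdx (𝓞 ℚ) = 1) (hf : 𝔭.asIdeal.inertiaDeg (𝓞 ℚ) = 1),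
          X11b.IMCLowerWaldspurgerOnTreeGoodAt p κ 𝔭 γ (X11b.embAt K p 𝔭 h𝔭 he hf) P)
    (W : WeierstrassCurve ℚ) [W.IsElliptic] [W.IsGloballyMinimal] (p : ℕ) [Fact p.Prime]
    (h : RowC3 W p) (hord : GoodOrd W p) (hp5 : 5 ≤ p) (htam0 : ¬ p ∣ W.tamagawaProduct) :
    BSDp W p := by
  obtain ⟨hr, hsst, hgood, hirr, -⟩ := h
  have hram : Ram W p :=
    JetchevSkinnerWan2017.ram_of_sec74_of_five_le hRib W p hp5 hsst hgood hirr hr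
  exact bsdp_rankOne_of_onTreeGoodLinks_of_bcsThm112b hGZ hKo hB hBCS hGr hGZK hmod hpar hnf hHL hMaz
    hNS hLC hLA W p (by omega) hord hirr (X9.bigIm_of_irr_of_ram W p hirr hram) hr htam0

end Summit.BirchSwinnertonDyer.Rank1Residual

end
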